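import Mathlib

/-!
# Zeros of binary quadratic forms modulo prime powers

Auxiliary file (theorems only, no definitions) for the proof of **Heath-Brown's bound for primitive
zeros of a ternary quadratic form in a box** (`Literature.NumberTheory.DiophantineGeometry.
TernaryConicPointBound`, [Heathbrown2002, Cor. 2], discharged in `TernaryConicPointBoundProofs`).

The printed proof ([Heathbrown1997, §2, proof of Thm 2], into which [Heathbrown2002] substitutes its
bound (1.8)) diagonalises the ternary form `q` modulo `p^e` for each `p^e ∥ Δ` and shows that the zeros
lie on `≤ d₃(p^γ)` lattices of determinant `≥ p^{γ - β}`.  We replace lattices by the following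
pairing-based reformulation, which avoids diagonalisation and treats `p = 2` uniformly: the zeros are
covered by few classes on which the POLAR form `Q(z + z') - Q(z) - Q(z')` is divisible by the modulus
(so that the Gram determinant of three zeros in a class is large, see `TernaryConicPointBoundPlane`).
This file proves the binary case, to which the ternary case reduces along a kernel vector
(`TernaryConicPointBoundLocal`).

* `TernaryConic.bin_labels` (**the binary lemma**): for a prime `ℓ`, a level `n` and an integral binary
  form `Q = a u² + h u v + b v²`, the zeros of `Q` modulo `ℓ^n` carry `≤ 3n + 3` labels such that two
  zeros with the same label have polar value `2a uu' + h(uv' + u'v) + 2b vv' ≡ 0 (mod ℓ^n)`.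

Proof: strong induction on `n`.  (a) `ℓ` divides all coefficients: divide (`labels_divide`).
(b) `ℓ ∤ disc(Q)`: a zero is `ℓ^j` times a primitive zero, whose ratio `t = u/v` (or `v/u`) is a
simple root of `a t² + h t + b` modulo `ℓ`, hence determined modulo `ℓ^{n-2j}` by its residue modulo
`ℓ` (`core_unitDisc`, via `f(t) - f(t') = (t - t')(a(t + t') + h)` and `(2at + h)² = 4a f(t) + disc`);
labels `(j, side, t mod ℓ)` (`labels_unitDisc`, at most two residues by `card_roots_mod_le_two`).
(c) `Q` primitive with `ℓ ∣ disc(Q)`: modulo `ℓ`, `Q` is a unit times `(l u + v)²` (`crit_odd`: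
`4bQ = (hu + 2bv)² - disc·u²`; `crit_two`: `Q ≡ au + v (mod 2)`), the zeros satisfy `v ≡ -l u`, and
substituting `v = ℓ w - l u` gives `Q = ℓ Q₁(u, w)` at level `n - 1` (`labels_shear`); the symmetric
case `ℓ ∣ b` is reduced to this one by swapping the variables (`labels_swap`).

## Design

Vectors are `ℤ × ℤ`, forms are triples of coefficients written inline (no definition is introduced),
labels are natural numbers together with a finite set containing the labels of all zeros.

## References

* D. R. Heath-Brown, *The density of rational points on cubic surfaces*, Acta Arith. 79 (1997)
  17–30, §2 (proof of Theorem 2) [Heathbrown1997].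
* D. R. Heath-Brown, *The density of rational points on curves and surfaces*, Ann. of Math. 155
  (2002) 553–595, Corollary 2 [Heathbrown2002].
-/

namespace Literature.NumberTheory.DiophantineGeometry

namespace TernaryConic

open Finset

/-- **Core of the unit-discriminant case.** For a binary form `a u² + h u v + b v²` whose
discriminant `h² - 4ab` is prime to `ℓ`, two zeros modulo `ℓ^m` (`m ≥ 1`) with `v, v'` units and the
same ratio `u/v ≡ u'/v' (mod ℓ)` have polar value `2a uu' + h(uv' + u'v) + 2b vv' ≡ 0 (mod ℓ^m)`:
the root `u/v` of `a t² + h t + b` modulo `ℓ` is simple, so it lifts uniquely. [folklore] -/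
theorem core_unitDisc {ℓ : ℤ} (hℓ : Prime ℓ) {a h b : ℤ} (hD : ¬ ℓ ∣ h ^ 2 - 4 * a * b)
    {m : ℕ} (hm : 1 ≤ m) {u v u' v' : ℤ} (hv : ¬ ℓ ∣ v) (hv' : ¬ ℓ ∣ v')
    (hz : ℓ ^ m ∣ a * u ^ 2 + h * u * v + b * v ^ 2)
    (hz' : ℓ ^ m ∣ a * u' ^ 2 + h * u' * v' + b * v' ^ 2)
    (hr : ℓ ∣ u * v' - u' * v) :
    ℓ ^ m ∣ 2 * a * u * u' + h * (u * v' + u' * v) + 2 * b * v * v' := by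
  set P : ℤ := ℓ ^ m with hP
  have hℓP : ℓ ∣ P := by rw [hP]; exact dvd_pow_self ℓ (by omega)
  -- inverses of `v`, `v'` modulo `P`
  have hcv : IsCoprime v P :=
    (((Prime.coprime_iff_not_dvd hℓ).2 hv)).symm.pow_right
  have hcv' : IsCoprime v' P :=
    (((Prime.coprime_iff_not_dvd hℓ).2 hv')).symm.pow_right
  obtain ⟨c, d, hcd⟩ := hcv
  obtain ⟨c', d', hcd'⟩ := hcv'
  -- `hcd : c * v + d * P = 1`
  set T : ℤ := u * c with hT
  set T' : ℤ := u' * c' with hT'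
  have hu : u - T * v = P * (u * d) := by rw [hT]; linear_combination (-u) * hcd
  have hu' : u' - T' * v' = P * (u' * d') := by rw [hT']; linear_combination (-u') * hcd'
  -- `P ∣ f(T)` and `P ∣ f(T')`
  have hfT : P ∣ a * T ^ 2 + h * T + b := by
    have h1 : P ∣ v ^ 2 * (a * T ^ 2 + h * T + b) := by
      have : v ^ 2 * (a * T ^ 2 + h * T + b) =
          (a * u ^ 2 + h * u * v + b * v ^ 2) - (u - T * v) * (a * (T * v + u) + h * v) := by ring
      rw [this, hu]
      exact dvd_sub hz ((dvd_mul_right P (u * d)).mul_right _)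
    have hcop : IsCoprime P (v ^ 2) := (IsCoprime.pow_left ⟨c, d, hcd⟩).symm
    exact hcop.dvd_of_dvd_mul_left h1
  have hfT' : P ∣ a * T' ^ 2 + h * T' + b := by
    have h1 : P ∣ v' ^ 2 * (a * T' ^ 2 + h * T' + b) := by
      have : v' ^ 2 * (a * T' ^ 2 + h * T' + b) =
          (a * u' ^ 2 + h * u' * v' + b * v' ^ 2) - (u' - T' * v') * (a * (T' * v' + u') + h * v') := by
        ring
      rw [this, hu']
      exact dvd_sub hz' ((dvd_mul_right P (u' * d')).mul_right _)
    have hcop : IsCoprime P (v' ^ 2) := (IsCoprime.pow_left ⟨c', d', hcd'⟩).symm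
    exact hcop.dvd_of_dvd_mul_left h1
  -- `T ≡ T' (mod ℓ)`
  have hTT' : ℓ ∣ T - T' := by
    have h1 : ℓ ∣ (T - T') * (v * v') := by
      have : (T - T') * (v * v') =
          (u * v' - u' * v) - u * v' * (d * P) + u' * v * (d' * P) := by
        rw [hT, hT']; linear_combination (u * v') * hcd - (u' * v) * hcd'
      rw [this]
      refine dvd_add (dvd_sub hr ?_) ?_
      · exact Dvd.dvd.mul_left (Dvd.dvd.mul_left hℓP _) _
      · exact Dvd.dvd.mul_left (Dvd.dvd.mul_left hℓP _) _
    rcases hℓ.dvd_or_dvd h1 with h2 | h2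
    · exact h2
    · rcases hℓ.dvd_or_dvd h2 with h3 | h3
      · exact absurd h3 hv
      · exact absurd h3 hv'
  -- the cofactor `a (T + T') + h` is a unit modulo `ℓ`
  have hunit : ¬ ℓ ∣ a * (T + T') + h := by
    intro hbad
    have h1 : ℓ ∣ 2 * a * T + h := by
      have : 2 * a * T + h = (a * (T + T') + h) + a * (T - T') := by ring
      rw [this]
      exact dvd_add hbad (Dvd.dvd.mul_left hTT' _)
    have h2 : ℓ ∣ (2 * a * T + h) ^ 2 - 4 * a * (a * T ^ 2 + h * T + b) :=
      dvd_sub (Dvd.dvd.pow h1 two_ne_zero) (Dvd.dvd.mul_left (dvd_trans hℓP hfT) _)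
    have : (2 * a * T + h) ^ 2 - 4 * a * (a * T ^ 2 + h * T + b) = h ^ 2 - 4 * a * b := by ring
    rw [this] at h2
    exact hD h2
  -- hence `P ∣ T - T'`
  have hPTT' : P ∣ T - T' := by
    have h1 : P ∣ (T - T') * (a * (T + T') + h) := by
      have : (T - T') * (a * (T + T') + h) =
          (a * T ^ 2 + h * T + b) - (a * T' ^ 2 + h * T' + b) := by ring
      rw [this]
      exact dvd_sub hfT hfT'
    exact hℓ.pow_dvd_of_dvd_mul_right _ hunit h1
  -- the polar value
  have hg : P ∣ 2 * a * T * T' + h * (T + T') + 2 * b := by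
    have : 2 * a * T * T' + h * (T + T') + 2 * b =
        (a * T ^ 2 + h * T + b) + (a * T' ^ 2 + h * T' + b) - a * ((T - T') * (T - T')) := by ring
    rw [this]
    exact dvd_sub (dvd_add hfT hfT') (Dvd.dvd.mul_left (Dvd.dvd.mul_right hPTT' _) _)
  have key : 2 * a * u * u' + h * (u * v' + u' * v) + 2 * b * v * v' =
      (u - T * v) * (2 * a * u' + h * v') + (u' - T' * v') * (2 * a * T * v + h * v)
        + v * v' * (2 * a * T * T' + h * (T + T') + 2 * b) := by ring
  rw [key, hu, hu']
  refine dvd_add (dvd_add ?_ ?_) (Dvd.dvd.mul_left hg _)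
  · exact (dvd_mul_right P (u * d)).mul_right _
  · exact (dvd_mul_right P (u' * d')).mul_right _

/-- A quadratic `a t² + h t + b` with discriminant prime to `ℓ` has at most two roots modulo the
prime `ℓ` among `0, …, ℓ - 1`. [folklore] -/
theorem card_roots_mod_le_two {ℓ : ℕ} (hℓ : ℓ.Prime) {a h b : ℤ}
    (hD : ¬ (ℓ : ℤ) ∣ h ^ 2 - 4 * a * b) :
    #((Finset.range ℓ).filter fun t : ℕ => (ℓ : ℤ) ∣ a * t ^ 2 + h * t + b) ≤ 2 := by
  have hℓ' : Prime (ℓ : ℤ) := Nat.prime_iff_prime_int.mp hℓ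
  by_contra hlt
  rw [not_le, Finset.two_lt_card_iff] at hlt
  obtain ⟨t1, t2, t3, h1, h2, h3, h12, h13, h23⟩ := hlt
  simp only [Finset.mem_filter, Finset.mem_range] at h1 h2 h3
  -- small differences are not divisible by `ℓ`
  have hnd : ∀ s t : ℕ, s < ℓ → t < ℓ → s ≠ t → ¬ (ℓ : ℤ) ∣ (s : ℤ) - t := by
    intro s t hs ht hst hdvd
    have habs : |(s : ℤ) - t| < ℓ := by
      rw [abs_lt]; constructor <;> omega
    have := Int.eq_zero_of_abs_lt_dvd hdvd habs
    omega
  have hdiff : ∀ s t : ℕ, (ℓ : ℤ) ∣ a * s ^ 2 + h * s + b → (ℓ : ℤ) ∣ a * t ^ 2 + h * t + b →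
      s < ℓ → t < ℓ → s ≠ t → (ℓ : ℤ) ∣ a * (s + t) + h := by
    intro s t hs ht hs' ht' hst
    have h1 : (ℓ : ℤ) ∣ ((s : ℤ) - t) * (a * (s + t) + h) := by
      have : ((s : ℤ) - t) * (a * (s + t) + h) =
          (a * s ^ 2 + h * s + b) - (a * t ^ 2 + h * t + b) := by ring
      rw [this]; exact dvd_sub hs ht
    rcases hℓ'.dvd_or_dvd h1 with h2 | h2
    · exact absurd h2 (hnd s t hs' ht' hst)
    · exact h2
  have e12 := hdiff t1 t2 h1.2 h2.2 h1.1 h2.1 h12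
  have e13 := hdiff t1 t3 h1.2 h3.2 h1.1 h3.1 h13
  have ha : (ℓ : ℤ) ∣ a := by
    have h4 : (ℓ : ℤ) ∣ a * ((t2 : ℤ) - t3) := by
      have : a * ((t2 : ℤ) - t3) = (a * (t1 + t2) + h) - (a * (t1 + t3) + h) := by ring
      rw [this]; exact dvd_sub e12 e13
    rcases hℓ'.dvd_or_dvd h4 with h5 | h5
    · exact h5
    · exact absurd h5 (hnd t2 t3 h2.1 h3.1 h23)
  have hh : (ℓ : ℤ) ∣ h := by
    have : h = (a * (t1 + t2) + h) - a * (t1 + t2) := by ring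
    rw [this]; exact dvd_sub e12 (Dvd.dvd.mul_right ha _)
  apply hD
  exact dvd_sub (Dvd.dvd.pow hh two_ne_zero) (Dvd.dvd.mul_right (Dvd.dvd.mul_left ha _) _)

/-- Criterion for an odd prime `ℓ`: if `ℓ ∤ b` and `ℓ` divides the discriminant, then modulo `ℓ`
the form `a u² + h u v + b v²` is a unit times the square of the linear form `l u + v`,
`l = h / (2b)`. [folklore] -/
theorem crit_odd {ℓ : ℤ} (hℓ : Prime ℓ) (hℓ2 : ¬ ℓ ∣ 2) {a h b : ℤ} (hb : ¬ ℓ ∣ b)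
    (hD : ℓ ∣ h ^ 2 - 4 * a * b) :
    ∃ l : ℤ, ∀ u v : ℤ, ℓ ∣ a * u ^ 2 + h * u * v + b * v ^ 2 ↔ ℓ ∣ l * u + v := by
  have h2b : ¬ ℓ ∣ 2 * b := fun h' => (hℓ.dvd_or_dvd h').elim hℓ2 hb
  have h4b : ¬ ℓ ∣ 4 * b := by
    intro h'
    rcases hℓ.dvd_or_dvd h' with h4 | h4
    · have : (4 : ℤ) = 2 * 2 := by norm_num
      rw [this] at h4
      exact (hℓ.dvd_or_dvd h4).elim hℓ2 hℓ2
    · exact hb h4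
  obtain ⟨c, d, hcd⟩ := ((Prime.coprime_iff_not_dvd hℓ).2 h2b).symm
  -- `hcd : c * (2 * b) + d * ℓ = 1`
  refine ⟨h * c, fun u v => ?_⟩
  have key : 4 * b * (a * u ^ 2 + h * u * v + b * v ^ 2) =
      (h * u + 2 * b * v) ^ 2 - (h ^ 2 - 4 * a * b) * u ^ 2 := by ring
  constructor
  · intro hq
    have h1 : ℓ ∣ (h * u + 2 * b * v) ^ 2 := by
      have : (h * u + 2 * b * v) ^ 2 =
          4 * b * (a * u ^ 2 + h * u * v + b * v ^ 2) + (h ^ 2 - 4 * a * b) * u ^ 2 := by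
        rw [key]; ring
      rw [this]
      exact dvd_add (Dvd.dvd.mul_left hq _) (Dvd.dvd.mul_right hD _)
    have h2 : ℓ ∣ h * u + 2 * b * v := hℓ.dvd_of_dvd_pow h1
    have : h * c * u + v = c * (h * u + 2 * b * v) + v * (d * ℓ) := by
      linear_combination (-v) * hcd
    rw [this]
    exact dvd_add (Dvd.dvd.mul_left h2 _) (Dvd.dvd.mul_left (dvd_mul_left ℓ d) v)
  · intro hl
    have h1 : ℓ ∣ h * u + 2 * b * v := by
      have : h * u + 2 * b * v = 2 * b * (h * c * u + v) + h * u * (d * ℓ) := by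
        linear_combination (-(h * u)) * hcd
      rw [this]
      exact dvd_add (Dvd.dvd.mul_left hl _) (Dvd.dvd.mul_left (dvd_mul_left ℓ d) _)
    have h2 : ℓ ∣ 4 * b * (a * u ^ 2 + h * u * v + b * v ^ 2) := by
      rw [key]
      exact dvd_sub (Dvd.dvd.pow h1 two_ne_zero) (Dvd.dvd.mul_right hD _)
    rcases hℓ.dvd_or_dvd h2 with h3 | h3
    · exact absurd h3 h4b
    · exact h3

/-- Criterion for `ℓ = 2`: if `b` is odd and `h` even, then `a u² + h u v + b v² ≡ a u + v (mod 2)`.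
[folklore] -/
theorem crit_two {a h b : ℤ} (hb : ¬ (2 : ℤ) ∣ b) (hh : (2 : ℤ) ∣ h) :
    ∀ u v : ℤ, (2 : ℤ) ∣ a * u ^ 2 + h * u * v + b * v ^ 2 ↔ (2 : ℤ) ∣ a * u + v := by
  intro u v
  have hb1 : (2 : ℤ) ∣ b - 1 := by
    rcases Int.even_or_odd b with ⟨k, hk⟩ | ⟨k, hk⟩
    · exact absurd ⟨k, by rw [hk]; ring⟩ hb
    · exact ⟨k, by rw [hk]; ring⟩
  have huu : (2 : ℤ) ∣ u * (u - 1) := by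
    have := Int.even_mul_succ_self (u - 1)
    rw [sub_add_cancel, mul_comm] at this
    exact even_iff_two_dvd.mp this
  have hvv : (2 : ℤ) ∣ v * (v - 1) := by
    have := Int.even_mul_succ_self (v - 1)
    rw [sub_add_cancel, mul_comm] at this
    exact even_iff_two_dvd.mp this
  have hdiff : (2 : ℤ) ∣ (a * u ^ 2 + h * u * v + b * v ^ 2) - (a * u + v) := by
    have : (a * u ^ 2 + h * u * v + b * v ^ 2) - (a * u + v) =
        a * (u * (u - 1)) + h * (u * v) + (b - 1) * v ^ 2 + v * (v - 1) := by ring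
    rw [this]
    refine dvd_add (dvd_add (dvd_add ?_ ?_) ?_) hvv
    · exact Dvd.dvd.mul_left huu _
    · exact Dvd.dvd.mul_right hh _
    · exact Dvd.dvd.mul_right hb1 _
  constructor
  · intro hq
    have := dvd_sub hq hdiff
    rwa [sub_sub_cancel] at this
  · intro hl
    have := dvd_add hl hdiff
    rwa [add_sub_cancel] at this


/-- **Unit-discriminant case of the binary lemma.** If `ℓ ∤ h² - 4ab` and `n ≥ 1`, the zeros of
`a u² + h u v + b v²` modulo `ℓ^n` carry at most `3n + 3` labels such that two zeros with the same
label have polar value divisible by `ℓ^n`. Labels: "deep" (`ℓ^{⌈n/2⌉}` divides both coordinates),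
or `(j, side, root mod ℓ)` with `ℓ^j` the exact power dividing the vector. [folklore] -/
theorem labels_unitDisc {ℓ : ℕ} (hℓ : ℓ.Prime) {n : ℕ} (hn : 1 ≤ n) {a h b : ℤ}
    (hD : ¬ (ℓ : ℤ) ∣ h ^ 2 - 4 * a * b) :
    ∃ (lab : ℤ × ℤ → ℕ) (L : Finset ℕ), #L ≤ 3 * n + 3 ∧
      (∀ z : ℤ × ℤ, (ℓ : ℤ) ^ n ∣ a * z.1 ^ 2 + h * z.1 * z.2 + b * z.2 ^ 2 → lab z ∈ L) ∧
      (∀ z z' : ℤ × ℤ, (ℓ : ℤ) ^ n ∣ a * z.1 ^ 2 + h * z.1 * z.2 + b * z.2 ^ 2 →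
        (ℓ : ℤ) ^ n ∣ a * z'.1 ^ 2 + h * z'.1 * z'.2 + b * z'.2 ^ 2 → lab z = lab z' →
        (ℓ : ℤ) ^ n ∣ 2 * a * z.1 * z'.1 + h * (z.1 * z'.2 + z'.1 * z.2) + 2 * b * z.2 * z'.2) := by
  classical
  haveI : Fact ℓ.Prime := ⟨hℓ⟩
  have hℓ' : Prime (ℓ : ℤ) := Nat.prime_iff_prime_int.mp hℓ
  set P : ℤ := (ℓ : ℤ) with hPdef
  have hP0 : P ≠ 0 := by rw [hPdef]; exact_mod_cast hℓ.ne_zero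
  set k : ℕ := (n + 1) / 2 with hk
  have hk1 : 1 ≤ k := by omega
  have hkn : k ≤ n := by omega
  have h2k : n ≤ 2 * k := by omega
  -- the exact power of `ℓ` dividing a vector
  let J : ℤ × ℤ → ℕ := fun z => Nat.findGreatest (fun j => P ^ j ∣ z.1 ∧ P ^ j ∣ z.2) n
  have hJdvd : ∀ z, P ^ J z ∣ z.1 ∧ P ^ J z ∣ z.2 := by
    intro z
    exact Nat.findGreatest_spec (P := fun j => P ^ j ∣ z.1 ∧ P ^ j ∣ z.2) (Nat.zero_le n)
      ⟨by simp, by simp⟩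
  have hJlt : ∀ z, ¬ (P ^ k ∣ z.1 ∧ P ^ k ∣ z.2) → J z < k := by
    intro z hz
    by_contra hge
    rw [not_lt] at hge
    exact hz ⟨(pow_dvd_pow P hge).trans (hJdvd z).1, (pow_dvd_pow P hge).trans (hJdvd z).2⟩
  have hJmax : ∀ z, ¬ (P ^ k ∣ z.1 ∧ P ^ k ∣ z.2) → ¬ (P ^ (J z + 1) ∣ z.1 ∧ P ^ (J z + 1) ∣ z.2) := by
    intro z hz
    exact Nat.findGreatest_is_greatest (P := fun j => P ^ j ∣ z.1 ∧ P ^ j ∣ z.2)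
      (Nat.lt_succ_self _) (by have := hJlt z hz; omega)
  -- reduced vector, side and residue
  let U : ℤ × ℤ → ℤ := fun z => z.1 / P ^ J z
  let V : ℤ × ℤ → ℤ := fun z => z.2 / P ^ J z
  have hU : ∀ z, z.1 = P ^ J z * U z := fun z => (Int.mul_ediv_cancel' (hJdvd z).1).symm
  have hV : ∀ z, z.2 = P ^ J z * V z := fun z => (Int.mul_ediv_cancel' (hJdvd z).2).symm
  let R : ℤ × ℤ → ℕ := fun z => ((U z : ZMod ℓ) * ((V z : ZMod ℓ))⁻¹).val
  let lab : ℤ × ℤ → ℕ := fun z =>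
    if P ^ k ∣ z.1 ∧ P ^ k ∣ z.2 then 0
    else if ¬ P ∣ V z then Nat.pair (J z) (Nat.pair 1 (R z)) + 1
    else Nat.pair (J z) (Nat.pair 2 0) + 1
  -- the finite set of labels
  set Roots : Finset ℕ := (Finset.range ℓ).filter fun t : ℕ => (ℓ : ℤ) ∣ a * t ^ 2 + h * t + b
    with hRoots
  have hRoots2 : #Roots ≤ 2 := card_roots_mod_le_two hℓ hD
  let enc : ℕ × ℕ × ℕ → ℕ := fun x => Nat.pair x.1 (Nat.pair x.2.1 x.2.2) + 1
  set L : Finset ℕ := {0} ∪ ((Finset.range n) ×ˢ (({1} : Finset ℕ) ×ˢ Roots ∪ {((2 : ℕ), (0 : ℕ))})).image enc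
    with hL
  have hlab0 : ∀ w : ℤ × ℤ, (P ^ k ∣ w.1 ∧ P ^ k ∣ w.2) → lab w = 0 := fun w hw => by
    simp only [lab, hw, and_self, if_true]
  have hlab1 : ∀ w : ℤ × ℤ, ¬ (P ^ k ∣ w.1 ∧ P ^ k ∣ w.2) → lab w ≠ 0 := fun w hw => by
    simp only [lab, hw, if_false]
    split_ifs <;> exact Nat.succ_ne_zero _
  refine ⟨lab, L, ?_, ?_, ?_⟩
  · -- cardinality
    calc #L ≤ #({0} : Finset ℕ) + #(((Finset.range n) ×ˢ
          (({1} : Finset ℕ) ×ˢ Roots ∪ {((2 : ℕ), (0 : ℕ))})).image enc) := Finset.card_union_le _ _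
      _ ≤ 1 + n * (#Roots + 1) := by
          rw [Finset.card_singleton]
          gcongr
          refine Finset.card_image_le.trans ?_
          rw [Finset.card_product, Finset.card_range]
          gcongr
          refine (Finset.card_union_le _ _).trans ?_
          rw [Finset.card_product, Finset.card_singleton, Finset.card_singleton, one_mul]
      _ ≤ 1 + n * (2 + 1) := by gcongr
      _ = 3 * n + 1 := by ring
      _ ≤ 3 * n + 3 := by omega
  · -- membership
    intro z hz
    by_cases hdeep : P ^ k ∣ z.1 ∧ P ^ k ∣ z.2
    · rw [hlab0 z hdeep, hL]
      exact Finset.mem_union_left _ (Finset.mem_singleton_self 0)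
    · have hJ := hJlt z hdeep
      have hm : 1 ≤ n - 2 * J z := by omega
      -- the reduced vector is a zero modulo `ℓ`
      have hred : (ℓ : ℤ) ∣ a * U z ^ 2 + h * U z * V z + b * V z ^ 2 := by
        have h1 : P ^ (2 * J z) * P ^ (n - 2 * J z) ∣
            P ^ (2 * J z) * (a * U z ^ 2 + h * U z * V z + b * V z ^ 2) := by
          rw [← pow_add, show 2 * J z + (n - 2 * J z) = n by omega]
          have : P ^ (2 * J z) * (a * U z ^ 2 + h * U z * V z + b * V z ^ 2) =
              a * z.1 ^ 2 + h * z.1 * z.2 + b * z.2 ^ 2 := by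
            rw [hU z, hV z]; ring
          rw [this]; exact hz
        have h2 := (mul_dvd_mul_iff_left (pow_ne_zero _ hP0)).mp h1
        exact (dvd_pow_self P (by omega)).trans h2
      simp only [lab, hdeep, if_false, hL]
      refine Finset.mem_union_right _ (Finset.mem_image.mpr ?_)
      by_cases hside : ¬ P ∣ V z
      · refine ⟨(J z, 1, R z), ?_, by simp [enc, hside]⟩
        simp only [Finset.mem_product, Finset.mem_range, Finset.mem_union, Finset.mem_singleton,
          Prod.mk.injEq]
        refine ⟨by omega, Or.inl ⟨trivial, ?_⟩⟩
        -- the residue is a root modulo `ℓ`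
        rw [hRoots, Finset.mem_filter, Finset.mem_range]
        refine ⟨ZMod.val_lt _, ?_⟩
        have hVne : (V z : ZMod ℓ) ≠ 0 := by
          rw [Ne, ZMod.intCast_zmod_eq_zero_iff_dvd]; exact hside
        rw [← ZMod.intCast_zmod_eq_zero_iff_dvd]
        have h0 : ((a * U z ^ 2 + h * U z * V z + b * V z ^ 2 : ℤ) : ZMod ℓ) = 0 := by
          rw [ZMod.intCast_zmod_eq_zero_iff_dvd]; exact hred
        push_cast at h0 ⊢
        rw [ZMod.natCast_val, ZMod.cast_id', id]
        have : (a : ZMod ℓ) * ((U z : ZMod ℓ) * ((V z : ZMod ℓ))⁻¹) ^ 2 +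
            (h : ZMod ℓ) * ((U z : ZMod ℓ) * ((V z : ZMod ℓ))⁻¹) + (b : ZMod ℓ) =
            ((a : ZMod ℓ) * (U z : ZMod ℓ) ^ 2 + (h : ZMod ℓ) * (U z) * (V z) + (b : ZMod ℓ) * (V z) ^ 2)
              * ((V z : ZMod ℓ))⁻¹ ^ 2 := by
          field_simp
        rw [this, h0, zero_mul]
      · exact ⟨(J z, 2, 0), by simp; omega, by simp [enc, hside]⟩
  · -- equal labels
    intro z z' hz hz' hlab
    by_cases hdeep : P ^ k ∣ z.1 ∧ P ^ k ∣ z.2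
    · -- both deep
      have hdeep' : P ^ k ∣ z'.1 ∧ P ^ k ∣ z'.2 := by
        by_contra hnd
        exact hlab1 z' hnd (hlab.symm.trans (hlab0 z hdeep))
      obtain ⟨⟨u1, hu1⟩, ⟨v1, hv1⟩⟩ := hdeep
      obtain ⟨⟨u1', hu1'⟩, ⟨v1', hv1'⟩⟩ := hdeep'
      have hnk : P ^ n ∣ P ^ k * P ^ k := by
        rw [← pow_add]; exact pow_dvd_pow P (by omega)
      have : 2 * a * z.1 * z'.1 + h * (z.1 * z'.2 + z'.1 * z.2) + 2 * b * z.2 * z'.2 =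
          P ^ k * P ^ k * (2 * a * u1 * u1' + h * (u1 * v1' + u1' * v1) + 2 * b * v1 * v1') := by
        rw [hu1, hv1, hu1', hv1']; ring
      rw [this]
      exact hnk.mul_right _
    · have hdeep' : ¬ (P ^ k ∣ z'.1 ∧ P ^ k ∣ z'.2) := fun hd' =>
        hlab1 z hdeep (hlab.trans (hlab0 z' hd'))
      have hJz := hJlt z hdeep
      have hJz' := hJlt z' hdeep'
      -- reduced zeros
      have hred : ∀ w : ℤ × ℤ, ¬ (P ^ k ∣ w.1 ∧ P ^ k ∣ w.2) →
          P ^ n ∣ a * w.1 ^ 2 + h * w.1 * w.2 + b * w.2 ^ 2 →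
          P ^ (n - 2 * J w) ∣ a * U w ^ 2 + h * U w * V w + b * V w ^ 2 := by
        intro w hw hwz
        have h1 : P ^ (2 * J w) * P ^ (n - 2 * J w) ∣
            P ^ (2 * J w) * (a * U w ^ 2 + h * U w * V w + b * V w ^ 2) := by
          rw [← pow_add, show 2 * J w + (n - 2 * J w) = n by have := hJlt w hw; omega]
          have : P ^ (2 * J w) * (a * U w ^ 2 + h * U w * V w + b * V w ^ 2) =
              a * w.1 ^ 2 + h * w.1 * w.2 + b * w.2 ^ 2 := by
            rw [hU w, hV w]; ring
          rw [this]; exact hwz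
        exact (mul_dvd_mul_iff_left (pow_ne_zero _ hP0)).mp h1
      -- unpack the label
      simp only [lab, hdeep, hdeep', if_false] at hlab
      by_cases hside : ¬ P ∣ V z
      · by_cases hside' : ¬ P ∣ V z'
        · simp only [hside, hside', not_false_eq_true, if_true, add_left_inj, Nat.pair_eq_pair] at hlab
          obtain ⟨hJJ, -, hRR⟩ := hlab
          -- same ratio modulo `ℓ`
          have hratio : (ℓ : ℤ) ∣ U z * V z' - U z' * V z := by
            have hVne : (V z : ZMod ℓ) ≠ 0 := by
              rw [Ne, ZMod.intCast_zmod_eq_zero_iff_dvd]; exact hside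
            have hVne' : (V z' : ZMod ℓ) ≠ 0 := by
              rw [Ne, ZMod.intCast_zmod_eq_zero_iff_dvd]; exact hside'
            have hR' := congrArg (fun t : ℕ => (t : ZMod ℓ)) hRR
            simp only [R, ZMod.natCast_val, ZMod.cast_id', id] at hR'
            rw [← ZMod.intCast_zmod_eq_zero_iff_dvd]
            push_cast
            rw [mul_inv_eq_iff_eq_mul₀ hVne] at hR'
            rw [hR']
            field_simp
            ring
          have hcore := core_unitDisc hℓ' hD (m := n - 2 * J z) (by omega) hside hside'
            (hred z hdeep hz) (by rw [hJJ]; exact hred z' hdeep' hz') hratio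
          have : 2 * a * z.1 * z'.1 + h * (z.1 * z'.2 + z'.1 * z.2) + 2 * b * z.2 * z'.2 =
              P ^ (2 * J z) * (2 * a * U z * U z' + h * (U z * V z' + U z' * V z)
                + 2 * b * V z * V z') := by
            rw [hU z, hV z, hU z', hV z', ← hJJ]; ring
          rw [this, show n = 2 * J z + (n - 2 * J z) by omega, pow_add]
          exact mul_dvd_mul_left _ hcore
        · exfalso
          simp only [hside, hside', not_false_eq_true, if_true, if_false, add_left_inj,
            Nat.pair_eq_pair] at hlab
          omega
      · by_cases hside' : ¬ P ∣ V z'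
        · exfalso
          simp only [hside, hside', not_false_eq_true, if_true, if_false, add_left_inj,
            Nat.pair_eq_pair] at hlab
          omega
        · simp only [hside, hside', if_false, add_left_inj, Nat.pair_eq_pair] at hlab
          obtain ⟨hJJ, -⟩ := hlab
          rw [not_not] at hside hside'
          -- the other side: `U z`, `U z'` are units
          have hUu : ¬ P ∣ U z := by
            intro hu
            apply hJmax z hdeep
            refine ⟨?_, ?_⟩
            · rw [hU z, pow_succ]; exact mul_dvd_mul_left _ hu
            · rw [hV z, pow_succ]; exact mul_dvd_mul_left _ hside
          have hUu' : ¬ P ∣ U z' := by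
            intro hu
            apply hJmax z' hdeep'
            refine ⟨?_, ?_⟩
            · rw [hU z', pow_succ]; exact mul_dvd_mul_left _ hu
            · rw [hV z', pow_succ]; exact mul_dvd_mul_left _ hside'
          have hD' : ¬ (ℓ : ℤ) ∣ h ^ 2 - 4 * b * a := by
            rw [show h ^ 2 - 4 * b * a = h ^ 2 - 4 * a * b by ring]; exact hD
          have hzr : P ^ (n - 2 * J z) ∣ b * V z ^ 2 + h * V z * U z + a * U z ^ 2 := by
            have := hred z hdeep hz
            rwa [show a * U z ^ 2 + h * U z * V z + b * V z ^ 2 =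
              b * V z ^ 2 + h * V z * U z + a * U z ^ 2 by ring] at this
          have hzr' : P ^ (n - 2 * J z) ∣ b * V z' ^ 2 + h * V z' * U z' + a * U z' ^ 2 := by
            have := hred z' hdeep' hz'
            rw [← hJJ] at this
            rwa [show a * U z' ^ 2 + h * U z' * V z' + b * V z' ^ 2 =
              b * V z' ^ 2 + h * V z' * U z' + a * U z' ^ 2 by ring] at this
          have hratio : (ℓ : ℤ) ∣ V z * U z' - V z' * U z :=
            dvd_sub (hside.mul_right _) (hside'.mul_right _)
          have hcore := core_unitDisc hℓ' hD' (m := n - 2 * J z) (by omega) hUu hUu' hzr hzr' hratio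
          have : 2 * a * z.1 * z'.1 + h * (z.1 * z'.2 + z'.1 * z.2) + 2 * b * z.2 * z'.2 =
              P ^ (2 * J z) * (2 * b * V z * V z' + h * (V z * U z' + V z' * U z)
                + 2 * a * U z * U z') := by
            rw [hU z, hV z, hU z', hV z', ← hJJ]; ring
          rw [this, show n = 2 * J z + (n - 2 * J z) by omega, pow_add]
          exact mul_dvd_mul_left _ hcore


/-- Transport of the binary lemma under the swap `(u, v) ↦ (v, u)`, i.e. from the form `(b, h, a)`
to the form `(a, h, b)`. [folklore] -/
theorem labels_swap {P : ℤ} {n N : ℕ} {a h b : ℤ}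
    (H : ∃ (lab : ℤ × ℤ → ℕ) (L : Finset ℕ), #L ≤ N ∧
      (∀ z : ℤ × ℤ, P ^ n ∣ b * z.1 ^ 2 + h * z.1 * z.2 + a * z.2 ^ 2 → lab z ∈ L) ∧
      (∀ z z' : ℤ × ℤ, P ^ n ∣ b * z.1 ^ 2 + h * z.1 * z.2 + a * z.2 ^ 2 →
        P ^ n ∣ b * z'.1 ^ 2 + h * z'.1 * z'.2 + a * z'.2 ^ 2 → lab z = lab z' →
        P ^ n ∣ 2 * b * z.1 * z'.1 + h * (z.1 * z'.2 + z'.1 * z.2) + 2 * a * z.2 * z'.2)) :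
    ∃ (lab : ℤ × ℤ → ℕ) (L : Finset ℕ), #L ≤ N ∧
      (∀ z : ℤ × ℤ, P ^ n ∣ a * z.1 ^ 2 + h * z.1 * z.2 + b * z.2 ^ 2 → lab z ∈ L) ∧
      (∀ z z' : ℤ × ℤ, P ^ n ∣ a * z.1 ^ 2 + h * z.1 * z.2 + b * z.2 ^ 2 →
        P ^ n ∣ a * z'.1 ^ 2 + h * z'.1 * z'.2 + b * z'.2 ^ 2 → lab z = lab z' →
        P ^ n ∣ 2 * a * z.1 * z'.1 + h * (z.1 * z'.2 + z'.1 * z.2) + 2 * b * z.2 * z'.2) := by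
  obtain ⟨lab, L, hL, hmem, hpol⟩ := H
  refine ⟨fun z => lab z.swap, L, hL, fun z hz => hmem z.swap ?_, fun z z' hz hz' hzz' => ?_⟩
  · simp only [Prod.fst_swap, Prod.snd_swap]
    rwa [show b * z.2 ^ 2 + h * z.2 * z.1 + a * z.1 ^ 2 = a * z.1 ^ 2 + h * z.1 * z.2 + b * z.2 ^ 2
      by ring]
  · have h1 := hpol z.swap z'.swap
    simp only [Prod.fst_swap, Prod.snd_swap] at h1
    have h2 := h1 (by rwa [show b * z.2 ^ 2 + h * z.2 * z.1 + a * z.1 ^ 2 =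
        a * z.1 ^ 2 + h * z.1 * z.2 + b * z.2 ^ 2 by ring])
      (by rwa [show b * z'.2 ^ 2 + h * z'.2 * z'.1 + a * z'.1 ^ 2 =
        a * z'.1 ^ 2 + h * z'.1 * z'.2 + b * z'.2 ^ 2 by ring]) hzz'
    rwa [show 2 * b * z.2 * z'.2 + h * (z.2 * z'.1 + z'.2 * z.1) + 2 * a * z.1 * z'.1 =
      2 * a * z.1 * z'.1 + h * (z.1 * z'.2 + z'.1 * z.2) + 2 * b * z.2 * z'.2 by ring] at h2

/-- Case (a) of the binary lemma: all coefficients divisible by `ℓ`; divide the form by `ℓ` and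
lower the level by one. [folklore] -/
theorem labels_divide {P : ℤ} (hP0 : P ≠ 0) {n N : ℕ} {a h b : ℤ}
    (H : ∃ (lab : ℤ × ℤ → ℕ) (L : Finset ℕ), #L ≤ N ∧
      (∀ z : ℤ × ℤ, P ^ n ∣ a * z.1 ^ 2 + h * z.1 * z.2 + b * z.2 ^ 2 → lab z ∈ L) ∧
      (∀ z z' : ℤ × ℤ, P ^ n ∣ a * z.1 ^ 2 + h * z.1 * z.2 + b * z.2 ^ 2 →
        P ^ n ∣ a * z'.1 ^ 2 + h * z'.1 * z'.2 + b * z'.2 ^ 2 → lab z = lab z' →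
        P ^ n ∣ 2 * a * z.1 * z'.1 + h * (z.1 * z'.2 + z'.1 * z.2) + 2 * b * z.2 * z'.2)) :
    ∃ (lab : ℤ × ℤ → ℕ) (L : Finset ℕ), #L ≤ N ∧
      (∀ z : ℤ × ℤ, P ^ (n + 1) ∣ (P * a) * z.1 ^ 2 + (P * h) * z.1 * z.2 + (P * b) * z.2 ^ 2 →
        lab z ∈ L) ∧
      (∀ z z' : ℤ × ℤ, P ^ (n + 1) ∣ (P * a) * z.1 ^ 2 + (P * h) * z.1 * z.2 + (P * b) * z.2 ^ 2 →
        P ^ (n + 1) ∣ (P * a) * z'.1 ^ 2 + (P * h) * z'.1 * z'.2 + (P * b) * z'.2 ^ 2 →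
        lab z = lab z' →
        P ^ (n + 1) ∣ 2 * (P * a) * z.1 * z'.1 + (P * h) * (z.1 * z'.2 + z'.1 * z.2)
          + 2 * (P * b) * z.2 * z'.2) := by
  obtain ⟨lab, L, hL, hmem, hpol⟩ := H
  have hred : ∀ z : ℤ × ℤ, P ^ (n + 1) ∣ (P * a) * z.1 ^ 2 + (P * h) * z.1 * z.2 + (P * b) * z.2 ^ 2 →
      P ^ n ∣ a * z.1 ^ 2 + h * z.1 * z.2 + b * z.2 ^ 2 := by
    intro z hz
    rw [pow_succ', show (P * a) * z.1 ^ 2 + (P * h) * z.1 * z.2 + (P * b) * z.2 ^ 2 =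
      P * (a * z.1 ^ 2 + h * z.1 * z.2 + b * z.2 ^ 2) by ring] at hz
    exact (mul_dvd_mul_iff_left hP0).mp hz
  refine ⟨lab, L, hL, fun z hz => hmem z (hred z hz), fun z z' hz hz' hzz' => ?_⟩
  rw [pow_succ', show 2 * (P * a) * z.1 * z'.1 + (P * h) * (z.1 * z'.2 + z'.1 * z.2)
      + 2 * (P * b) * z.2 * z'.2 =
    P * (2 * a * z.1 * z'.1 + h * (z.1 * z'.2 + z'.1 * z.2) + 2 * b * z.2 * z'.2) by ring]
  exact mul_dvd_mul_left P (hpol z z' (hred z hz) (hred z' hz') hzz')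

/-- Case (c) of the binary lemma: modulo `ℓ` the form is a unit times `(l u + v)²`; the zeros lie
in the lattice `v ≡ -l u`, on which the form is `ℓ` times the form
`Q₁(u, w) = Q(u, ℓ w - l u)/ℓ`; labels for `Q₁` at level `n` give labels for `Q` at level `n + 1`.
[folklore] -/
theorem labels_shear {P : ℤ} (hP0 : P ≠ 0) {n N : ℕ} {a h b a₁ : ℤ} (l : ℤ)
    (ha₁ : P * a₁ = a - h * l + b * l ^ 2)
    (hcrit : ∀ u v : ℤ, P ∣ a * u ^ 2 + h * u * v + b * v ^ 2 → P ∣ l * u + v)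
    (H : ∃ (lab : ℤ × ℤ → ℕ) (L : Finset ℕ), #L ≤ N ∧
      (∀ z : ℤ × ℤ, P ^ n ∣ a₁ * z.1 ^ 2 + (h - 2 * b * l) * z.1 * z.2 + (P * b) * z.2 ^ 2 →
        lab z ∈ L) ∧
      (∀ z z' : ℤ × ℤ, P ^ n ∣ a₁ * z.1 ^ 2 + (h - 2 * b * l) * z.1 * z.2 + (P * b) * z.2 ^ 2 →
        P ^ n ∣ a₁ * z'.1 ^ 2 + (h - 2 * b * l) * z'.1 * z'.2 + (P * b) * z'.2 ^ 2 →
        lab z = lab z' →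
        P ^ n ∣ 2 * a₁ * z.1 * z'.1 + (h - 2 * b * l) * (z.1 * z'.2 + z'.1 * z.2)
          + 2 * (P * b) * z.2 * z'.2)) :
    ∃ (lab : ℤ × ℤ → ℕ) (L : Finset ℕ), #L ≤ N ∧
      (∀ z : ℤ × ℤ, P ^ (n + 1) ∣ a * z.1 ^ 2 + h * z.1 * z.2 + b * z.2 ^ 2 → lab z ∈ L) ∧
      (∀ z z' : ℤ × ℤ, P ^ (n + 1) ∣ a * z.1 ^ 2 + h * z.1 * z.2 + b * z.2 ^ 2 →
        P ^ (n + 1) ∣ a * z'.1 ^ 2 + h * z'.1 * z'.2 + b * z'.2 ^ 2 → lab z = lab z' →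
        P ^ (n + 1) ∣ 2 * a * z.1 * z'.1 + h * (z.1 * z'.2 + z'.1 * z.2) + 2 * b * z.2 * z'.2) := by
  obtain ⟨lab, L, hL, hmem, hpol⟩ := H
  -- the substitution `w = (l u + v)/ℓ`
  let W : ℤ × ℤ → ℤ := fun z => (l * z.1 + z.2) / P
  have hW : ∀ z : ℤ × ℤ, P ^ (n + 1) ∣ a * z.1 ^ 2 + h * z.1 * z.2 + b * z.2 ^ 2 →
      z.2 = P * W z - l * z.1 := by
    intro z hz
    have h1 : P ∣ l * z.1 + z.2 := hcrit z.1 z.2 ((dvd_pow_self P (Nat.succ_ne_zero n)).trans hz)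
    have h2 : P * W z = l * z.1 + z.2 := Int.mul_ediv_cancel' h1
    linarith
  have hQ : ∀ z : ℤ × ℤ, z.2 = P * W z - l * z.1 →
      a * z.1 ^ 2 + h * z.1 * z.2 + b * z.2 ^ 2 =
        P * (a₁ * z.1 ^ 2 + (h - 2 * b * l) * z.1 * W z + (P * b) * W z ^ 2) := by
    intro z hz
    rw [hz]; linear_combination (-(z.1 ^ 2)) * ha₁
  have hred : ∀ z : ℤ × ℤ, P ^ (n + 1) ∣ a * z.1 ^ 2 + h * z.1 * z.2 + b * z.2 ^ 2 →
      P ^ n ∣ a₁ * z.1 ^ 2 + (h - 2 * b * l) * z.1 * W z + (P * b) * W z ^ 2 := by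
    intro z hz
    have h1 := hz
    rw [hQ z (hW z hz), pow_succ'] at h1
    exact (mul_dvd_mul_iff_left hP0).mp h1
  refine ⟨fun z => lab (z.1, W z), L, hL, fun z hz => hmem _ (hred z hz), fun z z' hz hz' hzz' => ?_⟩
  have h1 := hpol (z.1, W z) (z'.1, W z') (hred z hz) (hred z' hz') hzz'
  simp only at h1
  have key : 2 * a * z.1 * z'.1 + h * (z.1 * z'.2 + z'.1 * z.2) + 2 * b * z.2 * z'.2 =
      P * (2 * a₁ * z.1 * z'.1 + (h - 2 * b * l) * (z.1 * W z' + z'.1 * W z)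
        + 2 * (P * b) * W z * W z') := by
    rw [hW z hz, hW z' hz']; linear_combination (-(2 * z.1 * z'.1)) * ha₁
  rw [key, pow_succ']
  exact mul_dvd_mul_left P h1

/-- **The binary lemma.** For a prime `ℓ`, a level `n` and an integral binary quadratic form
`Q(u, v) = a u² + h u v + b v²`, the zeros of `Q` modulo `ℓ^n` can be labelled with at most `3n + 3`
labels so that any two zeros `z, z'` with the same label have polar value
`Q(z + z') - Q(z) - Q(z') = 2a uu' + h(uv' + u'v) + 2b vv'` divisible by `ℓ^n`. (Equivalently: the
zeros lie on `≤ 3n + 3` sublattices on which `Q ≡ 0 (mod ℓ^n)` identically; this replaces the local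
diagonalisation in [Heathbrown1997, §2].) [folklore] -/
theorem bin_labels {ℓ : ℕ} (hℓ : ℓ.Prime) (n : ℕ) (a h b : ℤ) :
    ∃ (lab : ℤ × ℤ → ℕ) (L : Finset ℕ), #L ≤ 3 * n + 3 ∧
      (∀ z : ℤ × ℤ, (ℓ : ℤ) ^ n ∣ a * z.1 ^ 2 + h * z.1 * z.2 + b * z.2 ^ 2 → lab z ∈ L) ∧
      (∀ z z' : ℤ × ℤ, (ℓ : ℤ) ^ n ∣ a * z.1 ^ 2 + h * z.1 * z.2 + b * z.2 ^ 2 →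
        (ℓ : ℤ) ^ n ∣ a * z'.1 ^ 2 + h * z'.1 * z'.2 + b * z'.2 ^ 2 → lab z = lab z' →
        (ℓ : ℤ) ^ n ∣ 2 * a * z.1 * z'.1 + h * (z.1 * z'.2 + z'.1 * z.2) + 2 * b * z.2 * z'.2) := by
  have hℓ' : Prime (ℓ : ℤ) := Nat.prime_iff_prime_int.mp hℓ
  have hP0 : (ℓ : ℤ) ≠ 0 := by exact_mod_cast hℓ.ne_zero
  induction n using Nat.strong_induction_on generalizing a h b with
  | _ n IH =>
  rcases n with _ | n
  · -- level 0: one label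
    refine ⟨fun _ => 0, {0}, by simp, fun z _ => by simp, fun z z' _ _ _ => ?_⟩
    simp
  -- a step valid whenever `ℓ ∤ b` (used directly, or after swapping `u` and `v`)
  have step : ∀ a h b : ℤ, ¬ ((ℓ : ℤ) ∣ a ∧ (ℓ : ℤ) ∣ h ∧ (ℓ : ℤ) ∣ b) → ¬ (ℓ : ℤ) ∣ b →
      ∃ (lab : ℤ × ℤ → ℕ) (L : Finset ℕ), #L ≤ 3 * (n + 1) + 3 ∧
        (∀ z : ℤ × ℤ, (ℓ : ℤ) ^ (n + 1) ∣ a * z.1 ^ 2 + h * z.1 * z.2 + b * z.2 ^ 2 → lab z ∈ L) ∧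
        (∀ z z' : ℤ × ℤ, (ℓ : ℤ) ^ (n + 1) ∣ a * z.1 ^ 2 + h * z.1 * z.2 + b * z.2 ^ 2 →
          (ℓ : ℤ) ^ (n + 1) ∣ a * z'.1 ^ 2 + h * z'.1 * z'.2 + b * z'.2 ^ 2 → lab z = lab z' →
          (ℓ : ℤ) ^ (n + 1) ∣ 2 * a * z.1 * z'.1 + h * (z.1 * z'.2 + z'.1 * z.2)
            + 2 * b * z.2 * z'.2) := by
    intro a h b hprim hb
    by_cases hD : (ℓ : ℤ) ∣ h ^ 2 - 4 * a * b
    · -- case (c): a linear criterion modulo `ℓ`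
      have hcrit : ∃ l : ℤ, ∀ u v : ℤ,
          (ℓ : ℤ) ∣ a * u ^ 2 + h * u * v + b * v ^ 2 ↔ (ℓ : ℤ) ∣ l * u + v := by
        by_cases h2 : (ℓ : ℤ) ∣ 2
        · -- `ℓ = 2`
          have hℓ2 : (ℓ : ℤ) = 2 := by
            have h22 : ℓ ∣ 2 := by exact_mod_cast h2
            have := (Nat.prime_dvd_prime_iff_eq hℓ Nat.prime_two).mp h22
            exact_mod_cast this
          rw [hℓ2] at hD hb ⊢
          have hh : (2 : ℤ) ∣ h := by
            have h1 : (2 : ℤ) ∣ h ^ 2 := by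
              have : h ^ 2 = (h ^ 2 - 4 * a * b) + 2 * (2 * a * b) := by ring
              rw [this]; exact dvd_add hD (dvd_mul_right _ _)
            exact Int.prime_two.dvd_of_dvd_pow h1
          exact ⟨a, crit_two hb hh⟩
        · exact crit_odd hℓ' h2 hb hD
      obtain ⟨l, hl⟩ := hcrit
      have ha₁ : (ℓ : ℤ) ∣ a - h * l + b * l ^ 2 := by
        have := (hl 1 (-l)).mpr (by simp)
        rwa [show a * 1 ^ 2 + h * 1 * -l + b * (-l) ^ 2 = a - h * l + b * l ^ 2 by ring] at this
      obtain ⟨a₁, ha₁'⟩ := ha₁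
      have H := IH n (Nat.lt_succ_self n) a₁ (h - 2 * b * l) ((ℓ : ℤ) * b)
      have := labels_shear hP0 l ha₁'.symm (fun u v huv => (hl u v).mp huv) H
      refine this.imp fun lab => ?_
      rintro ⟨L, hL, h1, h2⟩
      exact ⟨L, hL.trans (by omega), h1, h2⟩
    · exact labels_unitDisc hℓ (Nat.succ_le_succ (Nat.zero_le n)) hD
  by_cases hprim : (ℓ : ℤ) ∣ a ∧ (ℓ : ℤ) ∣ h ∧ (ℓ : ℤ) ∣ b
  · -- case (a)
    obtain ⟨⟨a', rfl⟩, ⟨h', rfl⟩, ⟨b', rfl⟩⟩ := hprim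
    have H := IH n (Nat.lt_succ_self n) a' h' b'
    have := labels_divide hP0 H
    refine this.imp fun lab => ?_
    rintro ⟨L, hL, h1, h2⟩
    exact ⟨L, hL.trans (by omega), h1, h2⟩
  by_cases hb : (ℓ : ℤ) ∣ b
  · by_cases ha : (ℓ : ℤ) ∣ a
    · -- `ℓ ∣ a`, `ℓ ∣ b`, hence `ℓ ∤ h`: unit discriminant
      have hh : ¬ (ℓ : ℤ) ∣ h := fun hh => hprim ⟨ha, hh, hb⟩
      have hD : ¬ (ℓ : ℤ) ∣ h ^ 2 - 4 * a * b := by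
        intro hD
        apply hh
        have h1 : (ℓ : ℤ) ∣ h ^ 2 := by
          have : h ^ 2 = (h ^ 2 - 4 * a * b) + 4 * a * b := by ring
          rw [this]; exact dvd_add hD ((ha.mul_left 4).mul_right b)
        exact hℓ'.dvd_of_dvd_pow h1
      exact labels_unitDisc hℓ (Nat.succ_le_succ (Nat.zero_le n)) hD
    · -- `ℓ ∤ a`: swap the variables
      have hprim' : ¬ ((ℓ : ℤ) ∣ b ∧ (ℓ : ℤ) ∣ h ∧ (ℓ : ℤ) ∣ a) :=
        fun h' => hprim ⟨h'.2.2, h'.2.1, h'.1⟩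
      exact labels_swap (step b h a hprim' ha)
  · exact step a h b hprim hb

end TernaryConic

end Literature.NumberTheory.DiophantineGeometry
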